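import Literature.AlgebraicGeometry.HodgeTheory.HodgeGroupProductCMFactor
import Literature.AlgebraicGeometry.HodgeTheory.WeilSurfaceCMSquare
import Literature.NumberTheory.EllipticCurves.CMEndomorphismOfMulMemLattice
import Literature.NumberTheory.DiophantineGeometry.AVIsogenyTateFreeHomProofs
import Literature.AlgebraicGeometry.Motives.AbelianVarietyDimZeroProofs
import Mathlib.Tactic.Module
import HarnessLib

/-!
# `Shioda1981_exists_cmType_prod_not_productSpan` holds: the square of a CM elliptic curve

Family `hodge`, layer `Literature/AlgebraicGeometry/HodgeTheory`; theorem-only companion of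
`HodgeGroupProductCMFactor`, where the named fact (cone fact #17 of the cell `pub-hodge-ring2`)

  `Shioda1981_exists_cmType_prod_not_productSpan :`
  `  ∃ A C, Milne1999.IsOfCMType A ∧ Milne1999.IsOfCMType C ∧ ¬ HodgeClassesProductSpan A C`

is stated. This file proves it (`Shioda1981_exists_cmType_prod_not_productSpan_holds`).

HONEST SCOPE. The fact AS TYPED quantifies over all pairs of complex abelian varieties of CM type,
and is therefore already witnessed by `A = C = E₀`, ONE elliptic curve with complex multiplication:
for such a pair `Hg(E₀ × E₀) = Hg(E₀)` acts diagonally, `≠ Hg(E₀) × Hg(E₀)`, and the rational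
`(1,1)`-classes of `E₀ × E₀` coming from `H¹ ⊗ H¹` (graphs of endomorphisms) are not in the span of
the product classes `pr₁^* a ∪ pr₂^* b` — Moonen–Zarhin 1999, §3 (3.1) with display (1), `m = n = 1`:
"This holds if and only if for some `m` and `n` the Hodge ring `B(X₁^m × X₂^n)` is not generated by
the elements coming from `B(X₁^m)` and `B(X₂^n)`." Shioda's finer statement (Lombardo 2016,
Remark 4.6: a SIMPLE CM threefold `Y` and a CM elliptic curve `E`, `Hom(Y, E) = 0`, with
`Hg(Y × E) ≠ Hg(Y) × Hg(E)`) is NOT what the typed fact says and is NOT what is proved here; the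
file discharges the fact exactly as the tree states it. Context: the cell's line is a research
route conditional on HC_CM, not a corollary of anything here; this discharge is tightness
information for `Lombardo2016_hodgeClassesProductSpan` (the CM curve `E₀` is of type IV, so
`HasNoTypeIVFactor E₀` fails and there is no conflict), not a step towards a summit statement.

## Proof

Let `E₀` be a complex abelian variety of dimension `1` with `ψ₀ ≫ ψ₀ = -(d • 𝟙)`, `d ≥ 1` (such a
pair exists for every `d`, `CMEndomorphism.exists_cmCurve_sqrt_neg`; `d = 1` is used).

* §1 `E₀` is of CM type (`isOfCMType_of_cmCurve`): `ℚ·1 + ℚ·ψ₀ ⊂ End⁰(E₀)` is a subalgebra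
  (`ψ₀² = -d`), commutative, reduced (a non-zero `s + tψ₀` is a unit, of norm `s² + dt² > 0`), of
  dimension `2 = 2 dim E₀` (`1, ψ₀` are independent as `End⁰(E₀) ≠ 0`). This is Milne's definition
  of CM type (§2, p. 54) verified by hand; the algebra is van Geemen's `K = ℚ(√-d) ⊂ End(X)_ℚ` (5.3).
* §2 On the curve: every endomorphism acts as the identity on `H⁰(E₀(ℂ); ℂ) = ℂ · 1`
  (`complexBetti_map_deg_zero_eq_self`: `f^* 1 = 1`), and `ψ₀^*`, `(-ψ₀)^*` act on the line
  `H²(E₀(ℂ); ℂ)` by `d = deg ψ₀` (`complexBetti_map_two_eq_smul`: in the rational basis `v, Tv` of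
  `H¹`, `T = ψ₀^*`, `T² = -d`, one computes `Ta ∪ Tb = d · (a ∪ b)`; `H•(E₀(ℂ)) = ⋀• H¹`,
  `HasExteriorCohomologyH1`).
* §3 On `B = E₀ × E₀` with `Φ = ψ₀ × (-ψ₀)` (`not_hodgeClassesProductSpan_cmSquare`): a generator
  `pr₁^* a ∪ pr₂^* b` of `hodgeProductClasses E₀ E₀ 1` has `(deg a, deg b) ∈ {(0, 2), (2, 0)}`, so
  by §2 `Φ^*(pr₁^* a ∪ pr₂^* b) = pr₁^*(ψ₀^* a) ∪ pr₂^*((-ψ₀)^* b) = d · (pr₁^* a ∪ pr₂^* b)`: the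
  span of the product classes lies in the `d`-eigenspace of `Φ^*`. The classes `u₊ ∈ E₊(B, Φ)`,
  `u₋ ∈ E₋(B, Φ)` of `exists_weilType_cmSquare` (van Geemen, proof of Lemma 5.2; Schoen §10) have
  `u₊ + u₋` rational of Hodge type `(1,1)` and non-zero (`E₊ ⊓ E₋ = 0`), while
  `Φ^* u_± = (± i√d)² · u_± = -d · u_±` (the test endomorphism `0·𝟙 + 1·Φ`). Were
  `HodgeClassesProductSpan E₀ E₀` true, `u₊ + u₋` would lie in the span, forcing
  `-d · (u₊ + u₋) = d · (u₊ + u₋)`, i.e. `2d · (u₊ + u₋) = 0` — a contradiction.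

Everything below is proved; no definition and no named fact is introduced (D-0026); the axioms of
the three theorems are the standard ones.

## References

* [MoonenZarhin1999LowDim] B. Moonen, Yu. Zarhin, Hodge classes on abelian varieties of low
  dimension, Math. Ann. 315 (1999) 711–733 (arXiv:math/9901113), §3 (3.1) and display (1).
* [Lombardo2016] D. Lombardo, On the ℓ-adic Galois representations attached to nonsimple abelian
  varieties, Ann. Inst. Fourier 66 (2016), Remark 4.6 (p. 1234).
* [Shioda1981FermatTypeAV] T. Shioda, Algebraic cycles on abelian varieties of Fermat type,
  Math. Ann. 258 (1981), §4.
* [vanGeemen1994HodgeAV] B. van Geemen, An introduction to the Hodge conjecture for abelian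
  varieties, LNM 1594 (1994), 5.3 and proof of Lemma 5.2.
* [Schoen1998HodgeWeilAddendum] C. Schoen, Addendum to: Hodge classes on self-products of a variety
  with an automorphism, Compositio Math. 114 (1998), §10.
* [Milne1999] J. S. Milne, Lefschetz motives and the Tate conjecture, Compositio Math. 117 (1999),
  §2 p. 54.
* [LangeBirkenhake1992] H. Lange, Ch. Birkenhake, Complex Abelian Varieties (1992), §1.1,
  Lemma 1.1.17.
* [HatcherAT2002] A. Hatcher, Algebraic Topology (2002), §3.2 Prop. 3.10.
* [MumfordAV1970] D. Mumford, Abelian Varieties (1970), §19 Thm. 3 and Cor. 2.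
-/

noncomputable section

open CategoryTheory MonoidalCategory CartesianMonoidalCategory
open Literature.AlgebraicTopology.SingularHomology
open Literature.AlgebraicGeometry.Motives

namespace Literature.AlgebraicGeometry.HodgeTheory

/-! ### §1 `ℚ[x] ≅ ℚ(√-d)` inside a `ℚ`-algebra: an elliptic curve with CM is of CM type -/

namespace CMQuadraticOrder

variable {R : Type*} [Ring R] [Algebra ℚ R] (x : R) {d : ℕ}

/-- `(s + t x)(s' + t' x) = (s s' - d t t') + (s t' + t s') x` when `x² = -d` (`d ∈ ℕ`). [folklore] -/
theorem pair_mul_pair (hx : x * x = -((d : ℚ) • (1 : R))) (s t s' t' : ℚ) :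
    (s • (1 : R) + t • x) * (s' • (1 : R) + t' • x) =
      (s * s' - d * t * t') • (1 : R) + (s * t' + t * s') • x := by
  simp only [mul_add, add_mul, smul_mul_smul_comm, one_mul, mul_one, hx, smul_neg]
  module

/-- For `d ≥ 1` a non-zero `s + t x` (`x² = -d`) is a unit: `(s + t x)(s - t x) = s² + d t² ≠ 0`.
[folklore] -/
theorem isUnit_pair (hx : x * x = -((d : ℚ) • (1 : R))) (hd : 0 < d) {s t : ℚ}
    (hst : ¬ (s = 0 ∧ t = 0)) : IsUnit (s • (1 : R) + t • x) := by
  have hd' : (0 : ℚ) < d := Nat.cast_pos.2 hd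
  have hq : 0 < s ^ 2 + d * t ^ 2 := by
    rcases not_and_or.1 hst with hs | ht
    · positivity
    · positivity
  have h1 : (s • (1 : R) + t • x) * (s • (1 : R) + (-t) • x) = (s ^ 2 + d * t ^ 2) • (1 : R) := by
    rw [pair_mul_pair x hx]; module
  have h2 : (s • (1 : R) + (-t) • x) * (s • (1 : R) + t • x) = (s ^ 2 + d * t ^ 2) • (1 : R) := by
    rw [pair_mul_pair x hx]; module
  refine ⟨⟨_, (s ^ 2 + d * t ^ 2)⁻¹ • (s • (1 : R) + (-t) • x), ?_, ?_⟩, rfl⟩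
  · rw [mul_smul_comm, h1, smul_smul, inv_mul_cancel₀ hq.ne', one_smul]
  · rw [smul_mul_assoc, h2, smul_smul, inv_mul_cancel₀ hq.ne', one_smul]

/-- `ℚ·1 + ℚ·x` is closed under multiplication (`x² = -d`). [folklore] -/
theorem span_pair_mul_mem (hx : x * x = -((d : ℚ) • (1 : R))) {y z : R}
    (hy : y ∈ Submodule.span ℚ {(1 : R), x}) (hz : z ∈ Submodule.span ℚ {(1 : R), x}) :
    y * z ∈ Submodule.span ℚ {(1 : R), x} := by
  obtain ⟨s, t, rfl⟩ := Submodule.mem_span_pair.1 hy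
  obtain ⟨s', t', rfl⟩ := Submodule.mem_span_pair.1 hz
  rw [pair_mul_pair x hx]
  exact Submodule.mem_span_pair.2 ⟨_, _, rfl⟩

variable {S : Subalgebra ℚ R}

/-- Membership in a subalgebra `S` with underlying submodule `ℚ·1 + ℚ·x` (`S = ℚ[x]`). [folklore] -/
theorem mem_iff_of_toSubmodule_eq (hS : Subalgebra.toSubmodule S = Submodule.span ℚ {(1 : R), x})
    {y : R} : y ∈ S ↔ ∃ s t : ℚ, s • (1 : R) + t • x = y := by
  rw [← Subalgebra.mem_toSubmodule, hS, Submodule.mem_span_pair]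

/-- `ℚ[x]` is commutative. [folklore] -/
theorem comm_of_toSubmodule_eq (hx : x * x = -((d : ℚ) • (1 : R)))
    (hS : Subalgebra.toSubmodule S = Submodule.span ℚ {(1 : R), x}) :
    ∀ y ∈ S, ∀ z ∈ S, y * z = z * y := by
  intro y hy z hz
  obtain ⟨s, t, rfl⟩ := (mem_iff_of_toSubmodule_eq x hS).1 hy
  obtain ⟨s', t', rfl⟩ := (mem_iff_of_toSubmodule_eq x hS).1 hz
  rw [pair_mul_pair x hx, pair_mul_pair x hx]
  module

/-- For `d ≥ 1` and `R ≠ 0`, `ℚ[x]` is reduced (every non-zero element is a unit). [folklore] -/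
theorem isReduced_of_toSubmodule_eq [Nontrivial R] (hx : x * x = -((d : ℚ) • (1 : R))) (hd : 0 < d)
    (hS : Subalgebra.toSubmodule S = Submodule.span ℚ {(1 : R), x}) : IsReduced S := by
  refine ⟨fun y ⟨k, hk⟩ => ?_⟩
  obtain ⟨s, t, hst⟩ := (mem_iff_of_toSubmodule_eq x hS).1 y.2
  have hk' : (y : R) ^ k = 0 := by simpa using congrArg Subtype.val hk
  by_contra hy0
  have hst0 : ¬ (s = 0 ∧ t = 0) := by
    rintro ⟨rfl, rfl⟩
    exact hy0 (Subtype.ext (by rw [← hst]; simp))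
  exact ((hst ▸ isUnit_pair x hx hd hst0).pow k).ne_zero hk'

/-- For `d ≥ 1` and `R ≠ 0`, `[ℚ[x] : ℚ] = 2` (`1, x` are independent: a relation `s + t x = 0` with
`(s, t) ≠ 0` would make the unit `s + t x` vanish). [folklore] -/
theorem finrank_of_toSubmodule_eq [Nontrivial R] (hx : x * x = -((d : ℚ) • (1 : R))) (hd : 0 < d)
    (hS : Subalgebra.toSubmodule S = Submodule.span ℚ {(1 : R), x}) :
    Module.finrank ℚ S = 2 := by
  have hli : LinearIndependent ℚ ![(1 : R), x] :=
    LinearIndependent.pair_iff.2 fun _ _ hst => by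
      by_contra h
      exact (isUnit_pair x hx hd h).ne_zero hst
  have hP : Submodule.span ℚ {(1 : R), x} = Submodule.span ℚ (Set.range ![(1 : R), x]) := by
    simp only [Matrix.range_cons, Matrix.range_empty, Set.union_empty, Set.singleton_union]
  rw [← Subalgebra.finrank_toSubmodule, hS, hP, finrank_span_eq_card hli, Fintype.card_fin]

end CMQuadraticOrder

section CMCurve

variable {E₀ : AbelianVariety ℂ} {d : ℕ} {ψ₀ : E₀ ⟶ E₀}

/-- **An elliptic curve with complex multiplication is of CM type** (`Milne1999.IsOfCMType`): for
`dim E₀ = 1` and `ψ₀ ≫ ψ₀ = -d`, `d ≥ 1`, the subalgebra `ℚ[ψ₀] = ℚ·1 + ℚ·ψ₀ ⊂ End⁰(E₀)` is reduced,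
commutative and of degree `2 = 2·dim E₀` (it is `≅ ℚ(√-d)`; `End⁰(E₀) ≠ 0` because `𝟙 ≠ 0`,
`not_isIsogeny_zero_of_dim_pos`, and `End ↪ End⁰`, `endAlgebra.of_injective_of_charZero`).
[cite: Milne1999, §2 p. 54 (definition of CM-type)] [cite: vanGeemen1994HodgeAV, 5.3]
[cite: MumfordAV1970, §19 Thm. 3 and Cor. 2] -/
theorem isOfCMType_of_cmCurve (hE : E₀.dim = 1) (hd : 0 < d) (hψ : ψ₀ ≫ ψ₀ = -(d • 𝟙 E₀)) :
    Milne1999.IsOfCMType E₀ := by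
  haveI : Nontrivial E₀.endAlgebra := by
    have h1 : (𝟙 E₀ : E₀ ⟶ E₀) ≠ 0 := fun h ↦
      AbelianVariety.not_isIsogeny_zero_of_dim_pos (X := E₀) (hE ▸ one_pos)
        (h ▸ AbelianVariety.isIsogeny_id E₀)
    refine ⟨⟨1, 0, fun h10 => h1 ?_⟩⟩
    have h : AbelianVariety.endAlgebra.of E₀ (1 : End E₀) = AbelianVariety.endAlgebra.of E₀ 0 := by
      rw [map_one, map_zero, h10]
    exact AbelianVariety.endAlgebra.of_injective_of_charZero (A := E₀) h
  have hψ' : End.of ψ₀ * End.of ψ₀ = -(d • (1 : End E₀)) := hψ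
  have hx : AbelianVariety.endAlgebra.of E₀ (End.of ψ₀) * AbelianVariety.endAlgebra.of E₀ (End.of ψ₀) =
      -((d : ℚ) • (1 : E₀.endAlgebra)) := by
    rw [← map_mul, hψ', map_neg, map_nsmul, map_one, Nat.cast_smul_eq_nsmul]
  set x := AbelianVariety.endAlgebra.of E₀ (End.of ψ₀)
  -- `S = ℚ[ψ₀] = ℚ·1 + ℚ·ψ₀ ⊂ End⁰(E₀)`
  let S : Subalgebra ℚ E₀.endAlgebra := (Submodule.span ℚ {(1 : E₀.endAlgebra), x}).toSubalgebra
    (Submodule.subset_span (Set.mem_insert _ _)) fun _ _ ↦ CMQuadraticOrder.span_pair_mul_mem x hx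
  have hS : Subalgebra.toSubmodule S = Submodule.span ℚ {(1 : E₀.endAlgebra), x} :=
    Submodule.toSubalgebra_toSubmodule _ _ _
  refine ⟨S, CMQuadraticOrder.isReduced_of_toSubmodule_eq x hx hd hS,
    CMQuadraticOrder.comm_of_toSubmodule_eq x hx hS, ?_⟩
  rw [CMQuadraticOrder.finrank_of_toSubmodule_eq x hx hd hS, hE]

/-! ### §2 Pull-backs on `H⁰` and `H²` of the curve -/

/-- `f^* = id` on `H⁰(E₀(ℂ); ℂ) = ℂ · 1` for every endomorphism `f` (`f^* 1 = 1`, and `H⁰` is spanned by the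
empty cup product `1`, `HasExteriorCohomologyH1`). [cite: HatcherAT2002, §3.2 Prop. 3.10] -/
theorem complexBetti_map_deg_zero_eq_self (f : E₀ ⟶ E₀) (a : complexBetti E₀.X 0) :
    complexBetti.map f.hom.hom.hom 0 a = a := by
  have hΛ := surface_hasExteriorCohomologyH1 E₀
  have key : (complexBetti.map f.hom.hom.hom 0).hom = LinearMap.id := by
    refine LinearMap.ext_on_range (hΛ.span_range_cupPowOne 0) fun u ↦ ?_
    rw [LinearMap.id_apply]
    exact map_cupPowOne _ 0 u
  exact LinearMap.congr_fun key a


/-- **`ψ₀^* = d` and `(-ψ₀)^* = d` on the line `H²(E₀(ℂ); ℂ)`** (`d = deg ψ₀`): in the rational basis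
`v, Tv` of `H¹` (`T = ψ₀^*`, `T² = -d`) one has `Ta ∪ Tb = d · (a ∪ b)` (the determinant of
`(0 -d; 1 0)` is `d`), and `H²` is spanned by the products `a ∪ b` (`HasExteriorCohomologyH1`); the sign
`(-1)² = 1` for `-ψ₀`. [cite: LangeBirkenhake1992, Lemma 1.1.17 (b)] [cite: HatcherAT2002, §3.2 Prop. 3.10] -/
theorem complexBetti_map_two_eq_smul (hE : E₀.dim = 1) (hd : 0 < d) (hψ : ψ₀ ≫ ψ₀ = -(d • 𝟙 E₀))
    (a : complexBetti E₀.X 2) :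
    complexBetti.map ψ₀.hom.hom.hom 2 a = (d : ℂ) • a ∧
      complexBetti.map (-ψ₀).hom.hom.hom 2 a = (d : ℂ) • a := by
  classical
  set T := (complexBetti.map ψ₀.hom.hom.hom 1).hom with hTdef
  have hT2 : ∀ c, T (T c) = -((d : ℂ) • c) := fun c ↦ complexBetti_map_map_one_of_comp_self hψ c
  obtain ⟨v, hv, hv0⟩ := exists_isRationalClass_ne_zero_one hE
  have hli : LinearIndependent ℂ ![v, T v] := linearIndependent_pair_map_one hd hψ hv hv0
  haveI : Module.Finite ℂ (complexBetti E₀.X 1) := finite_complexBetti_abelianVariety E₀ 1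
  have hcard : Fintype.card (Fin 2) = Module.finrank ℂ (complexBetti E₀.X 1) := by
    rw [Fintype.card_fin, finrank_complexBetti_one_of_dim_eq_one hE]
  let bE := basisOfLinearIndependentOfCardEqFinrank hli hcard
  have hbE : ∀ j, bE j = ![v, T v] j := fun j ↦ by
    rw [coe_basisOfLinearIndependentOfCardEqFinrank]
  set P := cupProduct (X := Motives.ComplexPoints E₀.X) (R := ℂ) (rfl : 1 + 1 = 2) with hP
  have hvv : P v v = 0 := cup_self_deg_one v
  have htt : P (T v) (T v) = 0 := cup_self_deg_one (T v)
  have htv : P (T v) v = -P v (T v) := by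
    have h := cupProduct_gradedComm_holds ℂ (Motives.ComplexPoints E₀.X) (rfl : 1 + 1 = 2) rfl (T v) v
    simpa using h
  -- `T a ∪ T b = d · (a ∪ b)` for `a, b ∈ H¹`
  have hprod : ∀ a b : complexBetti E₀.X 1, P (T a) (T b) = (d : ℂ) • P a b := by
    intro a b
    have ha := bE.sum_repr a
    have hb := bE.sum_repr b
    rw [Fin.sum_univ_two, hbE, hbE] at ha hb
    simp only [Matrix.cons_val_zero, Matrix.cons_val_one] at ha hb
    rw [← ha, ← hb]
    simp only [map_add, map_smul, LinearMap.add_apply, LinearMap.smul_apply, hT2, map_neg,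
      LinearMap.neg_apply, hvv, htt, htv, smul_zero, neg_zero, add_zero, zero_add, smul_neg,
      neg_neg, smul_add, smul_smul]
    module
  have hΛ := surface_hasExteriorCohomologyH1 E₀
  have hP2 : ∀ w : Fin 2 → complexBetti E₀.X 1,
      cupPowOne ℂ (Motives.ComplexPoints E₀.X) 2 w = P (w 0) (w 1) := by
    intro w
    rw [cupPowOne_succ, Fin.tail_def]
    simp only [cupPowOne_one]
    rfl
  -- an endomorphism `g` with `g^*a ∪ g^*b = d · (a ∪ b)` on `H¹ × H¹` acts by `d` on `H²`
  have hext : ∀ g : E₀ ⟶ E₀, (∀ a b : complexBetti E₀.X 1,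
      P ((complexBetti.map g.hom.hom.hom 1).hom a) ((complexBetti.map g.hom.hom.hom 1).hom b) =
        (d : ℂ) • P a b) →
      ∀ a : complexBetti E₀.X 2, complexBetti.map g.hom.hom.hom 2 a = (d : ℂ) • a := by
    intro g hg a
    have key : (complexBetti.map g.hom.hom.hom 2).hom = (d : ℂ) • LinearMap.id := by
      refine LinearMap.ext_on_range (hΛ.span_range_cupPowOne 2) fun u ↦ ?_
      rw [LinearMap.smul_apply, LinearMap.id_apply]
      have h1 : (complexBetti.map g.hom.hom.hom 2).hom (cupPowOne ℂ (Motives.ComplexPoints E₀.X) 2 u) =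
          cupPowOne ℂ (Motives.ComplexPoints E₀.X) 2
            (fun i ↦ (complexBetti.map g.hom.hom.hom 1).hom (u i)) :=
        map_cupPowOne _ 2 u
      rw [h1, hP2, hP2]
      exact hg (u 0) (u 1)
    exact LinearMap.congr_fun key a
  have hnegT : ∀ c, (complexBetti.map (-ψ₀).hom.hom.hom 1).hom c = -(T c) := fun c ↦ by
    change complexBetti.map (-ψ₀).hom.hom.hom 1 c = _
    rw [complexBetti_map_neg_one]
    rfl
  refine ⟨hext ψ₀ hprod a, hext (-ψ₀) (fun a b ↦ ?_) a⟩
  rw [hnegT, hnegT]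
  simp only [map_neg, LinearMap.neg_apply, neg_neg]
  exact hprod a b

end CMCurve

/-! ### §3 The Hodge classes of `E₀ × E₀` are not spanned by products of Hodge classes of the factors -/

section CMSquare

variable {E₀ : AbelianVariety ℂ} {d : ℕ} {ψ₀ : E₀ ⟶ E₀}

/-- **`¬ HodgeClassesProductSpan E₀ E₀` for a CM elliptic curve `E₀`.** With `Φ = ψ₀ × (-ψ₀)` on
`B = E₀ × E₀`: every product class `pr₁^* a ∪ pr₂^* b` (`a ∈ H^{2l}(E₀)`, `b ∈ H^{2k}(E₀)`,
`(l, k) ∈ {(1,0),(0,1)}`) satisfies `Φ^* x = d · x` (`ψ₀^*`, `(-ψ₀)^*` act by `1` on `H⁰` and by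
`d` on `H²`), whereas the rational `(1,1)`-class `u₊ + u₋ ≠ 0` of `exists_weilType_cmSquare`
(`u_± ∈ E_±(B, Φ)`) satisfies `Φ^*(u₊ + u₋) = (i√d)² · (u₊ + u₋) = -d · (u₊ + u₋)`; as `d ≠ -d`, it is
not in the span of the product classes — `Hg(E₀ × E₀) = Hg(E₀)` (diagonal) `≠ Hg(E₀) × Hg(E₀)`,
Moonen–Zarhin (3.1) display (1) with `m = n = 1`. [cite: MoonenZarhin1999LowDim, §3 (3.1)]
[cite: vanGeemen1994HodgeAV, 5.3 and proof of Lemma 5.2] -/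
theorem not_hodgeClassesProductSpan_cmSquare (hE : E₀.dim = 1) (hd : 0 < d)
    (hψ : ψ₀ ≫ ψ₀ = -(d • 𝟙 E₀)) : ¬ HodgeClassesProductSpan E₀ E₀ := by
  intro hS
  obtain ⟨-, -, -, up, um, hup, hum, hrat, htype, hup0, -⟩ := exists_weilType_cmSquare hE hd hψ
  -- view the classes on the scheme `E₀.X ⊗ E₀.X = (E₀.prod E₀).X` (`prod_X`, `rfl`)
  change ↥(complexBetti (E₀.X ⊗ E₀.X) (2 * 1)) at up um
  set Φ : E₀.prod E₀ ⟶ E₀.prod E₀ := AbelianVariety.prodLift (AbelianVariety.fst E₀ E₀ ≫ ψ₀)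
    (AbelianVariety.snd E₀ E₀ ≫ (-ψ₀)) with hΦ
  -- the witness `w = u₊ + u₋ ≠ 0`
  have hne : up + um ≠ 0 := by
    intro h0
    have hup' : up = -um := eq_neg_of_add_eq_zero_left h0
    have hmem : up ∈ weilClassesMinus (E₀.prod E₀) Φ 1 d := by
      rw [hup']
      exact Submodule.neg_mem _ hum
    exact hup0 ((Submodule.disjoint_def.1
      (disjoint_weilClassesPlus_weilClassesMinus (E₀.prod E₀) Φ one_pos hd)) up hup hmem)
  -- `Φ^* w = -d · w`
  set F : complexBetti (E₀.X ⊗ E₀.X) (2 * 1) →ₗ[ℂ] complexBetti (E₀.X ⊗ E₀.X) (2 * 1) :=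
    (complexBetti.map Φ.hom.hom.hom (2 * 1)).hom with hF
  have hΦ01 : (0 : ℕ) • 𝟙 (E₀.prod E₀) + (1 : ℕ) • Φ = Φ := by rw [zero_nsmul, one_nsmul, zero_add]
  have hsq : (Complex.I * (Real.sqrt d : ℂ)) ^ (2 * 1) = -(d : ℂ) := by
    rw [mul_one, I_mul_sqrt_sq]
  have hFw : F (up + um) = (-(d : ℂ)) • (up + um) := by
    have h1 := (mem_weilClassesPlus_iff.1 hup) 0 1
    have h2 := (mem_weilClassesMinus_iff.1 hum) 0 1
    rw [hΦ01] at h1 h2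
    have hc1 : (((0 : ℕ) : ℂ) + ((1 : ℕ) : ℂ) * Complex.I * (Real.sqrt d : ℂ)) ^ (2 * 1) = -(d : ℂ) := by
      rw [Nat.cast_zero, Nat.cast_one, zero_add, one_mul, hsq]
    have hc2 : (((0 : ℕ) : ℂ) - ((1 : ℕ) : ℂ) * Complex.I * (Real.sqrt d : ℂ)) ^ (2 * 1) = -(d : ℂ) := by
      rw [Nat.cast_zero, Nat.cast_one, zero_sub, one_mul, neg_pow, hsq]
      norm_num
    rw [hc1] at h1
    rw [hc2] at h2
    change F up = (-(d : ℂ)) • up at h1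
    change F um = (-(d : ℂ)) • um at h2
    rw [map_add, h1, h2, smul_add]
  -- every product class is in the `d`-eigenspace of `Φ^*`
  have hp₁ : Φ ≫ AbelianVariety.fst E₀ E₀ = AbelianVariety.fst E₀ E₀ ≫ ψ₀ :=
    AbelianVariety.prodLift_fst _ _
  have hp₂ : Φ ≫ AbelianVariety.snd E₀ E₀ = AbelianVariety.snd E₀ E₀ ≫ (-ψ₀) :=
    AbelianVariety.prodLift_snd _ _
  have hprod : ∀ x ∈ hodgeProductClasses E₀ E₀ 1, F x = (d : ℂ) • x := by
    rintro x ⟨l, k, hlk, a, b, -, -, -, -, rfl⟩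
    -- `Φ^*(pr₁^* a ∪ pr₂^* b) = pr₁^*(ψ₀^* a) ∪ pr₂^*((-ψ₀)^* b)`
    have hFx : F (cupProduct hlk (complexBetti.map (fst E₀.X E₀.X) (2 * l) a)
        (complexBetti.map (snd E₀.X E₀.X) (2 * k) b)) =
        cupProduct (X := Motives.ComplexPoints (E₀.X ⊗ E₀.X)) hlk
          ((complexBetti.map Φ.hom.hom.hom (2 * l)).hom (complexBetti.map (fst E₀.X E₀.X) (2 * l) a))
          ((complexBetti.map Φ.hom.hom.hom (2 * k)).hom (complexBetti.map (snd E₀.X E₀.X) (2 * k) b)) :=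
      cupProduct_map _ hlk _ _
    have hXa : (complexBetti.map Φ.hom.hom.hom (2 * l)).hom (complexBetti.map (fst E₀.X E₀.X) (2 * l) a) =
        complexBetti.map (fst E₀.X E₀.X) (2 * l) (complexBetti.map ψ₀.hom.hom.hom (2 * l) a) := by
      have h := abelianVarietyHom_map_map_apply Φ (AbelianVariety.fst E₀ E₀) a
      rw [hp₁, ← abelianVarietyHom_map_map_apply] at h
      exact h
    have hYb : (complexBetti.map Φ.hom.hom.hom (2 * k)).hom (complexBetti.map (snd E₀.X E₀.X) (2 * k) b) =
        complexBetti.map (snd E₀.X E₀.X) (2 * k) (complexBetti.map (-ψ₀).hom.hom.hom (2 * k) b) := by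
      have h := abelianVarietyHom_map_map_apply Φ (AbelianVariety.snd E₀ E₀) b
      rw [hp₂, ← abelianVarietyHom_map_map_apply] at h
      exact h
    rw [hFx, hXa, hYb]
    -- `(l, k) = (0, 1)` or `(1, 0)`
    rcases Nat.eq_zero_or_pos l with rfl | hl
    · obtain rfl : k = 1 := by omega
      have ha : complexBetti.map ψ₀.hom.hom.hom (2 * 0) a = a := complexBetti_map_deg_zero_eq_self ψ₀ a
      have hb : complexBetti.map (snd E₀.X E₀.X) (2 * 1) (complexBetti.map (-ψ₀).hom.hom.hom (2 * 1) b) =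
          (d : ℂ) • complexBetti.map (snd E₀.X E₀.X) (2 * 1) b := by
        rw [← map_smul]
        exact congrArg _ (complexBetti_map_two_eq_smul hE hd hψ b).2
      rw [ha, hb, map_smul]
    · obtain rfl : l = 1 := by omega
      obtain rfl : k = 0 := by omega
      have ha : complexBetti.map (fst E₀.X E₀.X) (2 * 1) (complexBetti.map ψ₀.hom.hom.hom (2 * 1) a) =
          (d : ℂ) • complexBetti.map (fst E₀.X E₀.X) (2 * 1) a := by
        rw [← map_smul]
        exact congrArg _ (complexBetti_map_two_eq_smul hE hd hψ a).1
      have hb : complexBetti.map (-ψ₀).hom.hom.hom (2 * 0) b = b :=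
        complexBetti_map_deg_zero_eq_self (-ψ₀) b
      rw [ha, hb, map_smul, LinearMap.smul_apply]
  have hspan : ∀ x ∈ Submodule.span ℂ (hodgeProductClasses E₀ E₀ 1), F x = (d : ℂ) • x := by
    intro x hx
    induction hx using Submodule.span_induction with
    | mem x hx => exact hprod x hx
    | zero => rw [map_zero, smul_zero]
    | add x y _ _ hx hy => rw [map_add, hx, hy, smul_add]
    | smul t x _ hx => rw [map_smul, hx, smul_comm]
  -- the witness is a rational `(1,1)`-class of `E₀ × E₀`, hence (by `hS`) in the span
  have hdim : E₀.dim + E₀.dim = 2 * 1 := by rw [hE]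
  have htype' : IsOfHodgeType (E₀.dim + E₀.dim) (E₀.X ⊗ E₀.X) (2 * 1) 1 1 (up + um) := by
    rw [hdim]
    exact htype
  have hw : up + um ∈ Submodule.span ℂ (hodgeProductClasses E₀ E₀ 1) := hS 1 (up + um) hrat htype'
  have h1 : F (up + um) = (d : ℂ) • (up + um) := hspan _ hw
  rw [hFw] at h1
  have h2 : (-(d : ℂ) + d) • (up + um) = ((d : ℂ) + d) • (up + um) := by
    rw [add_smul, add_smul, h1]
  rw [neg_add_cancel, zero_smul] at h2
  have hd2 : ((d : ℂ) + d) ≠ 0 := by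
    norm_cast
    omega
  exact hne ((smul_eq_zero.1 h2.symm).resolve_left hd2)

/-- **Cone fact #17 discharged: `Shioda1981_exists_cmType_prod_not_productSpan` holds** — AS TYPED
(`∃ A C` of CM type with `¬ HodgeClassesProductSpan A C`), witnessed by `A = C = E₀` a CM elliptic curve
(`exists_cmCurve_sqrt_neg 1`: `E₀ = ℂ/ℤ[i]`-type curve with `ψ₀² = -1`; `isOfCMType_of_cmCurve`;
`not_hodgeClassesProductSpan_cmSquare`). HONEST SCOPE: the typed statement quantifies over ALL pairs of
CM abelian varieties, so the square of one CM elliptic curve (`Hg(E₀ × E₀) = Hg(E₀) ≠ Hg(E₀) × Hg(E₀)`,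
Moonen–Zarhin (3.1) (1) with `m = n = 1`) already witnesses it; Shioda's finer point (a SIMPLE CM
threefold `Y` and a CM elliptic curve `E`, `Hom(Y, E) = 0`, with `Hg(Y × E) ≠ Hg(Y) × Hg(E)` — Lombardo
2016 Rem. 4.6) is NOT captured by the typed statement and is not what is proved here.
[cite: MoonenZarhin1999LowDim, §3 (3.1)] [cite: Lombardo2016, Remark 4.6 (p. 1234)] -/
theorem Shioda1981_exists_cmType_prod_not_productSpan_holds : Shioda1981_exists_cmType_prod_not_productSpan := by
  obtain ⟨E₀, ψ₀, hE, hψ⟩ :=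
    Literature.NumberTheory.EllipticCurves.CMEndomorphism.exists_cmCurve_sqrt_neg 1 one_pos
  exact ⟨E₀, E₀, isOfCMType_of_cmCurve hE one_pos hψ, isOfCMType_of_cmCurve hE one_pos hψ,
    not_hodgeClassesProductSpan_cmSquare hE one_pos hψ⟩

end CMSquare

end Literature.AlgebraicGeometry.HodgeTheory

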